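import Summits.KontsevichZagierPeriods.KontsevichZagierPeriods.Theorems.RootDecompWalshStrataEulerDescent12
import Summits.KontsevichZagierPeriods.KontsevichZagierPeriods.Theorems.RootDecompWalshStrataQuadDescent01

/-!
# Root decomposition & Walsh strata — the scaled rational class for `L³·W` denominators, part 1 (gen 8, §35.1–35.3)

The constant-radicand stratum of the line-wall sections of §34: `[T, N(t)/Q(t)·√m] ∈ InBaker` for
`0 < m ∈ ℚ`, `N ∈ ℚ[t]` arbitrary and the SPECIFIC denominators `Q = s·L³·W`, `L = k₁ + k₂t ≠ 0` on a
rational hull of `T ⊆ [0, 1]`, `W = κ₀ + κ₁t²` (`κ₀ > 0`, `κ₁ ≥ 0`), which is exactly the denominator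
of the boundary term `(γ/(3a))·M√M/(|L|L²W)` of the elliptic-polar engine along a rational line wall.
PROOF = partial fractions over `ℚ` + five atoms: Bézout splits `1/(L³W) = w/L³ + u/W` (`L³`, `W` coprime
since `W` has no real root); `N·w/L³ = q + n₂/L + n₁/L² + n₀/L³` by three divisions by the monic `X − a`
(`a = −k₁/k₂`); `N·u/W = q' + (αt + β)/W` by division by the monic `X² + κ₀/κ₁`.  The atoms: polynomial
(`sqrt_const_poly`, landed), simple and double pole (`sqrt_const_pole/_dpole`, landed), even part `β/W`
(`sqrt_const_even`, landed), and two NEW ones — the TRIPLE POLE `c√m/(t − a)³` (chart `t = a + m^{1/4}u`,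
rational pull-back `c/u³`; `m^{1/4} = √√m` is semialgebraic) and the ODD PART `c·t√m/W` (fold chart
`w = κ₀ + κ₁t²`, pull-back `(c/(2κ₁))√m/w`, a landed simple pole).  Additivity is organised by
`InBaker.peel_sqrt_const` (subtract one bounded rational·√m summand on the hull, `InBaker.of_sub'`).
Consequence (§34'): the hypothesis "scaled rational class" of `InBaker.sqrt_tangent/psection_line/
of_psector_walls` is discharged for every line wall. [KontsevichZagier2001 §1.2; Euler 1768; this node]
-/

noncomputable section

open Set MeasureTheory Literature.NumberTheory.Transcendental
open Literature.ModelTheory.ExponentialFields (IsSemialgebraic isSemialgebraic_univ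
  isSemialgebraic_setOf_eval_pos)

namespace Summit.KontsevichZagierPeriods.RootDecompWalshStrata.ConicDescent

/-! #### 35.1 Peeling one summand -/

/-- **PEEL.** On a domain inside a rational hull `[lo, hi]` on which `Q' ≠ 0`, an integrand
`N'/Q'·√m + G` is in `InBaker` as soon as `[T, N'/Q'·√m]` and `[T, G]` are: the first summand is bounded
and semialgebraic on `T`, hence a representation of its own (`bddRep`), and `InBaker.of_sub'` subtracts
it. [this node] -/
theorem InBaker.peel_sqrt_const (m : ℚ) (N' Q' : Polynomial ℚ) (lo hi : ℚ)
    (hQ' : ∀ x : ℝ, (lo : ℝ) ≤ x → x ≤ hi → Polynomial.aeval x Q' ≠ 0)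
    (r : KZ.IntegralRep 1) (hdom : ∀ v ∈ r.domain, (lo : ℝ) ≤ v 0 ∧ v 0 ≤ hi)
    (G : (Fin 1 → ℝ) → ℝ)
    (hr : EqOn r.integrand (fun v => Polynomial.aeval (v 0) N' / Polynomial.aeval (v 0) Q' *
      √(qD 0 0 m (v 0)) + G v) r.domain)
    (hA : ∀ rA : KZ.IntegralRep 1, rA.domain = r.domain →
      EqOn rA.integrand (fun v => Polynomial.aeval (v 0) N' / Polynomial.aeval (v 0) Q' *
        √(qD 0 0 m (v 0))) rA.domain → InBaker (KZ.of rA))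
    (hB : ∀ rB : KZ.IntegralRep 1, rB.domain = r.domain → EqOn rB.integrand G rB.domain →
      InBaker (KZ.of rB)) :
    InBaker (KZ.of r) := by
  have hSA := r.isSemialgebraic_domain
  have hsub : ∀ v ∈ r.domain, v 0 ∈ Icc (lo : ℝ) hi := fun v hv => ⟨(hdom v hv).1, (hdom v hv).2⟩
  have hb : Bornology.IsBounded r.domain :=
    (Metric.isBounded_Icc (fun _ : Fin 1 => (lo : ℝ)) (fun _ => (hi : ℝ))).subset fun v hv =>
      ⟨fun i => by rw [Subsingleton.elim i 0]; exact (hdom v hv).1,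
        fun i => by rw [Subsingleton.elim i 0]; exact (hdom v hv).2⟩
  have hcont : ContinuousOn (fun x : ℝ => Polynomial.aeval x N' / Polynomial.aeval x Q' *
      √(qD 0 0 m x)) (Icc (lo : ℝ) hi) :=
    (((Polynomial.continuous_aeval N').continuousOn.div (Polynomial.continuous_aeval Q').continuousOn
      fun x hx => hQ' x hx.1 hx.2).mul
      (by unfold qD; fun_prop : Continuous fun x : ℝ => √(qD 0 0 m x)).continuousOn)
  obtain ⟨M, hM⟩ := isCompact_Icc.exists_bound_of_continuousOn hcont
  have hF : IsSemialgebraicFunOn ℚ r.domain fun v => Polynomial.aeval (v 0) N' /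
      Polynomial.aeval (v 0) Q' * √(qD 0 0 m (v 0)) :=
    ((((IsRatOn.polyAeval N' IsRatOn.coord).div (IsRatOn.polyAeval Q' IsRatOn.coord) fun v hv =>
      hQ' _ (hdom v hv).1 (hdom v hv).2).isSemialgebraicFunOn hSA).mul_holds
      (IsSemialgebraicFunOn.sqrt_holds (isSemialgebraicFunOn_qD 0 0 m hSA))).congr fun v _ => by
        simp only [Pi.mul_apply]
  obtain ⟨rA, hAd, hAi⟩ : ∃ rA : KZ.IntegralRep 1, rA.domain = r.domain ∧
      rA.integrand = fun v => Polynomial.aeval (v 0) N' / Polynomial.aeval (v 0) Q' *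
        √(qD 0 0 m (v 0)) :=
    ⟨bddRep r.domain hSA hb _ hF M fun v hv => by
      rw [← Real.norm_eq_abs]; exact hM (v 0) (hsub v hv), rfl, rfl⟩
  refine InBaker.of_sub' r rA hAd (hA rA hAd fun v _ => by rw [hAi]) (hB _ rfl fun v hv => ?_)
  have hv' : v ∈ r.domain := hv
  show r.integrand v - rA.integrand v = G v
  rw [hAi, hr hv']
  ring

/-! #### 35.2 The triple pole -/

/-- Core of `InBaker.sqrt_const_tpole`: away from the pole, the chart `x = a + ρu`, `ρ = m^{1/4} = √√m`
(semialgebraic), pulls `c√m·dx/(x − a)³` back to the RATIONAL form `c·du/u³` (`√m·ρ/ρ³ = 1`). [this node] -/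
theorem sqrt_const_tpole_core (m a c : ℚ) (hm : 0 < m) (r' : KZ.IntegralRep 1)
    (hcov : ∀ x ∈ r'.domain, x 0 - a ≠ 0)
    (hr : EqOn r'.integrand (fun v => (c : ℝ) / (v 0 - a) ^ 3 * √(qD 0 0 m (v 0))) r'.domain) :
    InBaker (KZ.of r') := by
  obtain ⟨ρ, hρdef⟩ : ∃ ρ : ℝ, ρ = √(√(m : ℝ)) := ⟨_, rfl⟩
  have hm' : (0 : ℝ) < m := by exact_mod_cast hm
  have hρ : 0 < ρ := by rw [hρdef]; exact Real.sqrt_pos.2 (Real.sqrt_pos.2 hm')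
  have hρ2 : √(m : ℝ) = ρ ^ 2 := by rw [hρdef, Real.sq_sqrt (Real.sqrt_nonneg _)]
  have hqD : ∀ x : ℝ, qD 0 0 m x = m := fun x => by simp [qD]
  obtain ⟨T₀, hT₀def⟩ : ∃ T₀ : Set (Fin 1 → ℝ),
      T₀ = {v | v ∈ (univ : Set (Fin 1 → ℝ)) ∧ v 0 ≠ 0} := ⟨_, rfl⟩
  have hT₀ : IsSemialgebraic ℚ T₀ := by
    rw [hT₀def]; exact IsRatOn.isSemialgebraic_sep_ne_zero isSemialgebraic_univ IsRatOn.coord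
  have hT₀' : ∀ v ∈ T₀, v 0 ≠ 0 := fun v hv => by rw [hT₀def] at hv; exact hv.2
  have hsq : IsSemialgebraicFunOn ℚ T₀ fun _ : Fin 1 → ℝ => ρ :=
    (IsSemialgebraicFunOn.sqrt_holds (IsSemialgebraicFunOn.sqrt_holds
      (isSemialgebraicFunOn_ratCast hT₀ m))).congr fun v _ => by rw [hρdef]
  have hgS : IsSemialgebraicFunOn ℚ T₀ fun v => (a : ℝ) + ρ * v 0 :=
    ((isSemialgebraicFunOn_ratCast hT₀ a).add_holds (hsq.mul_holds
      (isSemialgebraicFunOn_apply hT₀ 0))).congr fun v _ => by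
        simp only [Pi.add_apply, Pi.mul_apply]
  refine InBaker.of_cov₁_rat r' hT₀ (fun s : ℝ => (a : ℝ) + ρ * s) (fun _ => ρ) hgS
    (fun v _ => (((hasDerivAt_id' (v 0)).const_mul ρ).const_add (a : ℝ)).congr_deriv (mul_one ρ))
    (fun s _ t _ hst => ?_) (fun x hx => ?_) (fun v => (c : ℝ) / v 0 ^ 3)
    ((IsRatOn.const c).div (IsRatOn.coord.pow 3) fun v hv => pow_ne_zero 3 (hT₀' v hv))
    fun v hv hvd => ?_
  · exact mul_left_cancel₀ hρ.ne' (add_left_cancel hst)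
  · have hy := hcov x hx
    refine ⟨fun _ => (x 0 - a) / ρ, ?_, ?_⟩
    · rw [hT₀def]; exact ⟨mem_univ _, div_ne_zero hy hρ.ne'⟩
    · change (a : ℝ) + ρ * ((x 0 - a) / ρ) = x 0
      rw [mul_div_cancel₀ _ hρ.ne']; ring
  · have hs := hT₀' v hv
    have hx' : r'.integrand (lift₁ (fun s : ℝ => (a : ℝ) + ρ * s) v) =
        (c : ℝ) / ((a : ℝ) + ρ * v 0 - a) ^ 3 * √(qD 0 0 m ((a : ℝ) + ρ * v 0)) := hr hvd
    rw [hx', hqD, hρ2, add_sub_cancel_left, abs_of_pos hρ]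
    have hρ0 := hρ.ne'
    field_simp

/-- **The scaled triple pole** `[T, c·√m/(x − a)³]`, `0 < m ∈ ℚ`, `a, c ∈ ℚ`, on ANY domain (the point
`x = a` is null; each side is `sqrt_const_tpole_core`). [this node] -/
theorem InBaker.sqrt_const_tpole (m a c : ℚ) (hm : 0 < m) (r : KZ.IntegralRep 1)
    (hr : EqOn r.integrand (fun v => (c : ℝ) / (v 0 - a) ^ 3 * √(qD 0 0 m (v 0))) r.domain) :
    InBaker (KZ.of r) := by
  refine InBaker.of_split_at a r (fun r₁ hd₁ hi₁ => ?_) fun r₁ hd₁ hi₁ => ?_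
  · refine sqrt_const_tpole_core m a c hm r₁ (fun x hx => ?_) fun v hv => ?_
    · rw [hd₁] at hx
      exact sub_ne_zero.2 (show (a : ℝ) < x 0 from hx.2).ne'
    · rw [hd₁] at hv; rw [hi₁]; exact hr hv.1
  · refine sqrt_const_tpole_core m a c hm r₁ (fun x hx => ?_) fun v hv => ?_
    · rw [hd₁] at hx
      exact sub_ne_zero.2 (show x 0 < (a : ℝ) from hx.2).ne
    · rw [hd₁] at hv; rw [hi₁]; exact hr hv.1

/-! #### 35.3 The odd part over `W = κ₀ + κ₁x²` -/

/-- Core of `InBaker.sqrt_const_oddW` (`κ₁ > 0`, `x > 0`): the fold chart `x = √((w − κ₀)/κ₁)`,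
`w = κ₀ + κ₁x² > κ₀`, pulls `c·x√m·dx/W` back to `(c/(2κ₁))·√m·dw/w`, a landed scaled simple pole
(`InBaker.sqrt_const_pole`). [this node] -/
theorem sqrt_const_oddW_core (m κ₀ κ₁ c : ℚ) (hm : 0 < m) (hκ₀ : 0 < κ₀) (hκ₁ : 0 < κ₁)
    (r' : KZ.IntegralRep 1) (hpos : ∀ x ∈ r'.domain, 0 < x 0)
    (hr : EqOn r'.integrand (fun v => (c : ℝ) * v 0 / (κ₀ + κ₁ * v 0 ^ 2) * √(qD 0 0 m (v 0)))
      r'.domain) :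
    InBaker (KZ.of r') := by
  have hκ₀' : (0 : ℝ) < κ₀ := by exact_mod_cast hκ₀
  have hκ₁' : (0 : ℝ) < κ₁ := by exact_mod_cast hκ₁
  have hqD : ∀ x : ℝ, qD 0 0 m x = m := fun x => by simp [qD]
  obtain ⟨T₀, hT₀def⟩ : ∃ T₀ : Set (Fin 1 → ℝ), T₀ = {w : Fin 1 → ℝ | (κ₀ : ℝ) < w 0} := ⟨_, rfl⟩
  have hT₀ : IsSemialgebraic ℚ T₀ := by
    rw [hT₀def]
    convert isSemialgebraic_setOf_eval_pos (k := ℚ) (R := ℝ)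
      (MvPolynomial.X (0 : Fin 1) - MvPolynomial.C κ₀ : MvPolynomial (Fin 1) ℚ) using 1
    ext w
    simp [sub_pos]
  have hT₀' : ∀ w ∈ T₀, (κ₀ : ℝ) < w 0 := fun w hw => by rw [hT₀def] at hw; exact hw
  have hT₀'' : ∀ w ∈ T₀, 0 < (w 0 - κ₀) / κ₁ := fun w hw => div_pos (sub_pos.2 (hT₀' w hw)) hκ₁'
  have hgS : IsSemialgebraicFunOn ℚ T₀ fun w => √((w 0 - (κ₀ : ℝ)) / κ₁) :=
    (IsSemialgebraicFunOn.sqrt_holds (((isSemialgebraicFunOn_apply hT₀ 0).sub_holds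
      (isSemialgebraicFunOn_ratCast hT₀ κ₀)).div (isSemialgebraicFunOn_ratCast hT₀ κ₁)
      fun _ _ => hκ₁'.ne')).congr fun w _ => by simp only [Pi.sub_apply]
  have hR : IsSemialgebraicFunOn ℚ T₀ fun w =>
      ((c / (2 * κ₁) : ℚ) : ℝ) / (w 0 - (0 : ℚ)) * √(qD 0 0 m (w 0)) :=
    (((isSemialgebraicFunOn_ratCast hT₀ (c / (2 * κ₁))).div ((isSemialgebraicFunOn_apply hT₀ 0).sub_holds
      (isSemialgebraicFunOn_ratCast hT₀ 0)) fun w hw => by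
        simp only [Pi.sub_apply, Rat.cast_zero, sub_zero]; exact (hκ₀'.trans (hT₀' w hw)).ne').mul_holds
      (IsSemialgebraicFunOn.sqrt_holds (isSemialgebraicFunOn_qD 0 0 m hT₀))).congr fun w _ => by
        simp only [Pi.mul_apply, Pi.sub_apply]
  refine InBaker.of_cov₁' r' hT₀ (fun w : ℝ => √((w - κ₀) / κ₁))
    (fun w => 1 / (2 * κ₁ * √((w - κ₀) / κ₁))) hgS (fun w hw => ?_) (fun s hs t ht hst => ?_)
    (fun x hx => ?_) _ hR (fun w hw hwd => ?_)
    fun r₂ _ hi₂ => InBaker.sqrt_const_pole m 0 (c / (2 * κ₁)) hm r₂ fun v _ => by rw [hi₂]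
  · have h := (((hasDerivAt_id' (w 0)).sub_const (κ₀ : ℝ)).div_const (κ₁ : ℝ)).sqrt
      (hT₀'' w hw).ne'
    refine h.congr_deriv ?_
    rw [div_div]
    ring
  · have h1 : (s 0 - κ₀) / κ₁ = (t 0 - κ₀) / κ₁ :=
      (Real.sqrt_inj (hT₀'' s hs).le (hT₀'' t ht).le).1 hst
    field_simp at h1
    linarith
  · have hx0 := hpos x hx
    refine ⟨fun _ => (κ₀ : ℝ) + κ₁ * x 0 ^ 2, ?_, ?_⟩
    · rw [hT₀def]
      show (κ₀ : ℝ) < κ₀ + κ₁ * x 0 ^ 2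
      have : (0 : ℝ) < κ₁ * x 0 ^ 2 := by positivity
      linarith
    · change √(((κ₀ : ℝ) + κ₁ * x 0 ^ 2 - κ₀) / κ₁) = x 0
      rw [add_sub_cancel_left, mul_div_cancel_left₀ _ hκ₁'.ne', Real.sqrt_sq hx0.le]
  · have hu := hT₀'' w hw
    set G := √((w 0 - (κ₀ : ℝ)) / κ₁) with hGdef
    have hG : 0 < G := Real.sqrt_pos.2 hu
    have hG2 : G ^ 2 = (w 0 - κ₀) / κ₁ := by rw [hGdef, Real.sq_sqrt hu.le]
    have hw0 : w 0 ≠ 0 := (hκ₀'.trans (hT₀' w hw)).ne'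
    have hx' : r'.integrand (lift₁ (fun w : ℝ => √((w - κ₀) / κ₁)) w) =
        (c : ℝ) * G / (κ₀ + κ₁ * G ^ 2) * √(qD 0 0 m G) := hr hwd
    have hW : (κ₀ : ℝ) + κ₁ * G ^ 2 = w 0 := by rw [hG2]; field_simp; ring
    rw [hx', hqD, hqD, hW, abs_of_pos (by positivity)]
    have hG0 := hG.ne'
    have hk0 := hκ₁'.ne'
    push_cast
    rw [sub_zero]
    field_simp

/-- **The scaled odd part** `[T, c·x·√m/(κ₀ + κ₁x²)]`, `0 < m`, `κ₀ > 0`, `κ₁ ≥ 0`, `T ⊆ [0, 1]`: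
`κ₁ = 0` is a polynomial (`sqrt_const_poly`); else the piece `x > 0` is `sqrt_const_oddW_core` and the
piece `x < 0` is empty. [this node] -/
theorem InBaker.sqrt_const_oddW (m κ₀ κ₁ c : ℚ) (hm : 0 < m) (hκ₀ : 0 < κ₀) (hκ₁ : 0 ≤ κ₁)
    (r : KZ.IntegralRep 1) (hI : ∀ v ∈ r.domain, 0 ≤ v 0 ∧ v 0 ≤ 1)
    (hr : EqOn r.integrand (fun v => (c : ℝ) * v 0 / (κ₀ + κ₁ * v 0 ^ 2) * √(qD 0 0 m (v 0)))
      r.domain) :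
    InBaker (KZ.of r) := by
  have hκ₀' : (0 : ℝ) < κ₀ := by exact_mod_cast hκ₀
  rcases hκ₁.eq_or_lt with hk | hk
  · refine InBaker.sqrt_const_poly m hm (Polynomial.C (c / κ₀) * Polynomial.X) r
      (fun v hv => ⟨fun i => by rw [Subsingleton.elim i 0]; exact (hI v hv).1,
        fun i => by rw [Subsingleton.elim i 0]; exact (hI v hv).2⟩) fun v hv => ?_
    rw [hr hv, ← hk]
    simp only [map_mul, Polynomial.aeval_C, Polynomial.aeval_X, eq_ratCast]
    push_cast
    simp only [zero_mul, add_zero]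
    ring
  · refine InBaker.of_split_at 0 r (fun r₁ hd₁ hi₁ => ?_) fun r₁ hd₁ _ => ?_
    · refine sqrt_const_oddW_core m κ₀ κ₁ c hm hκ₀ hk r₁ (fun x hx => ?_) fun v hv => ?_
      · rw [hd₁] at hx
        exact_mod_cast hx.2
      · rw [hd₁] at hv; rw [hi₁]; exact hr hv.1
    · refine InBaker.of_domain_eq_empty r₁ ?_
      rw [hd₁]
      ext v
      simp only [mem_setOf_eq, mem_empty_iff_false, iff_false, not_and, not_lt, Rat.cast_zero]
      exact fun hv => (hI v hv).1

end Summit.KontsevichZagierPeriods.RootDecompWalshStrata.ConicDescent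

end
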